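import Literature.Probability.RandomPlanarGeometry.SLERestrictionLemmas
import Literature.Probability.RandomPlanarGeometry.SLERestrictionHitReduction
import Literature.Probability.RandomPlanarGeometry.SLERestrictionHitStolz
import Literature.Probability.RandomPlanarGeometry.CritPercSLESimplePathProofs
import Literature.Probability.RandomPlanarGeometry.SLEBoundaryHittingProofs
import Literature.Probability.RandomPlanarGeometry.LocalMartingaleProofs
import HarnessLib

/-!
# [LSW] Lemma 6.3 along the SLE_{8/3} flow: the property `sle_restrictionDeriv_frequently_lt` holds for every smooth `*`-hull

Proof-only sibling of `SLERestrictionMartingale` (no definition, no named fact), after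

* G. F. Lawler, O. Schramm, W. Werner, *Conformal restriction: the chordal case*, J. Amer. Math.
  Soc. **16** (2003) 917–955, arXiv:math/0209343 (**[LSW]**), §6: Lemma 6.3 ("Let `A ∈ 𝒬*` be a
  smooth hull. Suppose that `T := inf{t ≥ 0 : K_t ∩ A ≠ ∅} < ∞` and `K_T ∩ A ∩ ℝ = ∅`. Set
  `A_t := g_t(A)`, `t < T`. Then `lim_{t ↗ T} Φ_{A_t}'(W_t) = 0`.") and its use in the proof of
  Thm. 6.1 ("Lemmas 6.2 and 6.3 show that `Y_T = 1_{T = ∞}` a.s.");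
* S. Rohde, O. Schramm, *Basic properties of SLE*, Ann. of Math. **161** (2005), Lemma 6.2 and
  the proof of Thm. 6.1 (p. 902) (simplicity of the trace for `κ ≤ 4`).

## What is proved, and about which statement

`Literature.Probability.RandomPlanarGeometry.sle_restrictionDeriv_frequently_lt` (file
`SLERestrictionMartingale`) is a PROPERTY OF THE HULL `A` — a predicate `Set ℂ → Prop` (its
binder is the section variable `A : Set ℂ` of that file), recording the conclusion of [LSW]
Lemma 6.3 along the SLE_{8/3} flow in the weak form the proof of Thm. 6.1 consumes: almost
surely, if the trace first hits `A` at the finite time `T`, then `Φ'_{A_s − W_s}(0) < ε` at times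
`s < T` arbitrarily close to `T`. It is not a closed statement: there is no
`theorem … : sle_restrictionDeriv_frequently_lt`, and its universal closure over `A : Set ℂ` is
FALSE — a set containing the starting point `0` of the trace is hit at time `T = 0`, before which
there are no times at all (`not_sle_restrictionDeriv_frequently_lt_singleton_zero`). Its printed
scope is [LSW] Lemma 6.3: SMOOTH hulls of `𝒬*`. This file proves exactly that scope, with no
hypothesis left:

* `sle_restrictionDeriv_frequently_lt_of_isSmoothHull` — **for every smooth `*`-hull `A`
  (`IsSmoothHull A`, `IsStarHull A`), `sle_restrictionDeriv_frequently_lt A` holds.**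

Inputs, all THEOREMS of the tree: the deterministic content of Lemma 6.3 for smooth hulls,
`Loewner.RestrictionDerivVanishesAtHit A` (`restrictionDerivVanishesAtHit_of_stolz` with
`IsSmoothHull.hitPath_stolz_holds`, files `SLERestrictionHitReduction`, `SLERestrictionHitStolz`);
Lawler's identification of the swallowing of real points with the hitting of real rays
(`sle_swallowingTime_ofReal_eq_firstHit_holds`, `SLEBoundaryHittingProofs`); and Rohde–Schramm's
Lemma 6.2 (`sle_swallowingTime_ofReal_eq_top_holds`, `CritPercSLESimplePathProofs`), which gives
the simplicity of the trace for every sample point WHOSE CHAIN IS GENERATED BY A CURVE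
(`ae_isSimpleTrace_sleTrace_of_isGeneratedByCurve`: the proof of
`ae_isSimpleTrace_sleTrace_of_hasSLETrace` read pathwise). The existence of the trace
(Rohde–Schramm Thm. 5.1, `HasSLETrace (8/3)`, in the tree still the named fact
`RohdeSchramm2005_thm36`) is NOT needed: for a sample point whose chain is not generated by a
curve, `sleTrace` is by definition the constant path `0 ∉ A` (`Loewner.trace`), so `T = ∞` and
the property is vacuous there (`isGeneratedByCurve_of_firstHit_ne_top`). Consequently the earlier
reduction `sle_restrictionDeriv_frequently_lt_of_vanishesAtHit` (`SLERestrictionLemmas`) loses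
its three hypotheses `hgen`, `h₆`, `hswallow`
(`sle_restrictionDeriv_frequently_lt_of_restrictionDerivVanishesAtHit`), and the step "Lemma 6.3
shows that `Y_T = 0` on `{T < ∞}`" of the proof of Thm. 6.1 holds for every restriction
martingale of a smooth `*`-hull (`IsRestrictionMartingale.ae_eq_zero_of_isSmoothHull`).

Not here: the companion property `sle_restrictionDeriv_frequently_gt` (Lemma 6.2, on `{T = ∞}`),
whose SLE form does use the transience of the trace and hence `HasSLETrace (8/3)`
(`SLERestrictionLocal`).
-/

noncomputable section

open Set Filter Topology MeasureTheory
open UpperHalfPlane (upperHalfPlaneSet)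
open scoped NNReal

namespace Literature.Probability.RandomPlanarGeometry

/-! ### Simplicity of the SLE_κ trace, `κ ≤ 4`, pathwise on generated chains -/

/-- **Rohde–Schramm's Thm. 6.1, pathwise-conditional form, from their Lemma 6.2 alone**: for
`κ ≤ 4`, almost surely, IF the SLE_κ chain of the sample point is generated by a curve, then its
trace is a simple trace (injective, in `ℍ` at positive times). This is the proof of
`ae_isSimpleTrace_sleTrace_of_hasSLETrace` (`CritPercSLESimplePathProofs`) with the hypothesis
`HasSLETrace κ` moved inside the almost-sure statement, where it is only used pointwise: a.s., for
every positive rational `q` the shifted chain swallows no real point but its starting point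
(`ae_forall_swallowingTime_shift_eq_top` with the proved `sle_swallowingTime_ofReal_eq_top_holds`,
un-recentred by `Loewner.swallowingTime_add_const`), and `Loewner.isSimpleTrace_trace_of_shift`
is deterministic. [cite: RohdeSchramm2005, Thm 6.1 and its proof (p. 902)] -/
theorem ae_isSimpleTrace_sleTrace_of_isGeneratedByCurve {κ : ℝ≥0} (hκ4 : κ ≤ 4) :
    ∀ᵐ ω ∂Process.preWienerMeasure, (∃ γ, Loewner.IsGeneratedByCurve (sleDriving κ ω) γ) →
      Loewner.IsSimpleTrace (sleTrace κ ω) := by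
  have hreal : ∀ᵐ ω ∂Process.preWienerMeasure, ∀ q : ℚ, 0 < q → ∀ x : ℝ,
      x ≠ sleDriving κ ω ((q : ℝ).toNNReal) →
        Loewner.swallowingTime (fun u ↦ sleDriving κ ω ((q : ℝ).toNNReal + u)) x = ⊤ := by
    rw [ae_all_iff]
    intro q
    filter_upwards [ae_forall_swallowingTime_shift_eq_top sle_swallowingTime_ofReal_eq_top_holds hκ4
      ((q : ℝ).toNNReal)] with ω hω _ x hx
    set c : ℝ := sleDriving κ ω ((q : ℝ).toNNReal) with hc
    have h1 := hω (x - c) (sub_ne_zero.2 hx)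
    have key := Loewner.swallowingTime_add_const
      (fun u ↦ sleDriving κ ω ((q : ℝ).toNNReal + u) - c) ((x - c : ℝ) : ℂ) c
    simp only [sub_add_cancel] at key
    rw [h1] at key
    have hxc : (((x - c : ℝ) : ℂ) + (c : ℂ)) = (x : ℂ) := by push_cast; ring
    rw [hxc] at key
    exact key
  filter_upwards [hreal] with ω h2 h1
  exact Loewner.isSimpleTrace_trace_of_shift (continuous_sleDriving κ ω) h1 h2

/-! ### Sample points whose chain is not generated by a curve -/

/-- When the SLE_κ chain of `ω` is not generated by a curve, the SLE trace is the constant path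
`0` (the documented junk value `W 0 = 0` of `Loewner.trace`). [folklore] -/
theorem sleTrace_of_not_isGeneratedByCurve {κ : ℝ≥0} {ω : ℝ≥0 → ℝ}
    (h : ¬ ∃ γ, Loewner.IsGeneratedByCurve (sleDriving κ ω) γ) (t : ℝ≥0) : sleTrace κ ω t = 0 := by
  change Loewner.trace (sleDriving κ ω) t = 0
  rw [Loewner.trace, dif_neg h, sleDriving_zero, Complex.ofReal_zero]

/-- **A finite hitting time forces a genuine trace**: if the SLE trace hits a set `A ∌ 0` at all
(`firstHit ≠ ⊤`), then the chain of that sample point is generated by a curve (otherwise the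
trace is the constant path `0`, which never meets `A`). [folklore] -/
theorem isGeneratedByCurve_of_firstHit_ne_top {κ : ℝ≥0} {ω : ℝ≥0 → ℝ} {A : Set ℂ}
    (h0 : (0 : ℂ) ∉ A) (hT : firstHit (sleTrace κ ω) A ≠ ⊤) :
    ∃ γ, Loewner.IsGeneratedByCurve (sleDriving κ ω) γ := by
  by_contra hgen
  exact hT (firstHit_eq_top fun t ht ↦ h0 (sleTrace_of_not_isGeneratedByCurve hgen t ▸ ht))

/-! ### [LSW] Lemma 6.3 along the SLE_{8/3} flow -/

section SLE

variable {A : Set ℂ} {Y : ℝ≥0 → (ℝ≥0 → ℝ) → ℝ}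

/-- **The property `sle_restrictionDeriv_frequently_lt A` of a `*`-hull from the deterministic
content of [LSW] Lemma 6.3 for `A` alone** — `sle_restrictionDeriv_frequently_lt_of_vanishesAtHit`
(`SLERestrictionLemmas`) without its hypotheses `hgen` (trace existence), `h₆` (simplicity) and
`hswallow` (swallowing = hitting): on the event `{T < ∞}` the chain is generated by its trace
(`isGeneratedByCurve_of_firstHit_ne_top`, as `0 ∉ A`), which is then almost surely simple
(`ae_isSimpleTrace_sleTrace_of_isGeneratedByCurve`, `8/3 ≤ 4`); so the hitting time of `A` by the
closed hulls is `T` (`isHullHitTime_of_firstHit_eq`) and no real point of `A` is swallowed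
(`not_swallowingTime_ofReal_le`, both with `sle_swallowingTime_ofReal_eq_firstHit_holds`), and
Lemma 6.3's conclusion for the driving function `√(8/3) B(ω)` applies; `T > 0` makes `𝓝[<] T`
proper. [cite: LawlerSchrammWerner2003Restriction, Lemma 6.3 and proof of Thm. 6.1 (§6)] -/
theorem sle_restrictionDeriv_frequently_lt_of_restrictionDerivVanishesAtHit (hA : IsStarHull A)
    (h63 : Loewner.RestrictionDerivVanishesAtHit A) : sle_restrictionDeriv_frequently_lt A := by
  have hκ4 : (8 : ℝ≥0) / 3 ≤ 4 := by
    rw [div_le_iff₀ (by norm_num : (0 : ℝ≥0) < 3)]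
    norm_num
  filter_upwards [ae_isSimpleTrace_sleTrace_of_isGeneratedByCurve hκ4] with ω hsω τ hτ ε hε
  have hgenω : ∃ γ, Loewner.IsGeneratedByCurve (sleDriving ((8 : ℝ≥0) / 3) ω) γ :=
    isGeneratedByCurve_of_firstHit_ne_top hA.zero_notMem (by rw [hτ]; exact WithTop.coe_ne_top)
  have hgen : Loewner.IsGeneratedByCurve (sleDriving ((8 : ℝ≥0) / 3) ω)
      (sleTrace ((8 : ℝ≥0) / 3) ω) :=
    Loewner.isGeneratedByCurve_trace hgenω
  have hs : Loewner.IsSimpleTrace (sleTrace ((8 : ℝ≥0) / 3) ω) := hsω hgenω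
  have hτ0 : 0 < τ := by
    have h := firstHit_sleTrace_pos ((8 : ℝ≥0) / 3) hA.isBoundedHull.isClosed hA.zero_notMem ω
    rw [hτ] at h
    exact_mod_cast h
  haveI : (𝓝[<] τ).NeBot := nhdsLT_neBot_of_exists_lt ⟨0, hτ0⟩
  exact (h63 (continuous_sleDriving _ ω) τ
    (isHullHitTime_of_firstHit_eq sle_swallowingTime_ofReal_eq_firstHit_holds hgen hs
      hA.isBoundedHull.isClosed hA.zero_notMem hτ)
    (fun x hx ↦ not_swallowingTime_ofReal_le sle_swallowingTime_ofReal_eq_firstHit_holds hgen hs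
      hA.zero_notMem hx τ) ε hε).frequently

/-- **[LSW] Lemma 6.3 along the SLE_{8/3} flow, unconditionally: every smooth `*`-hull `A` has
the property `sle_restrictionDeriv_frequently_lt A`.** Almost surely, if the SLE_{8/3} trace first
hits `A` at the finite time `T`, then for every `ε > 0` there are times `s < T` arbitrarily close
to `T` at which `Φ'_{A_s − W_s}(0) = Φ_{A_s}'(W_s) < ε`, for all restriction data of the slid hull
`A_s − W_s` — the printed "`lim_{t ↗ T} Φ_{A_t}'(W_t) = 0`" for smooth `A ∈ 𝒬*`, in the weak
form consumed by the proof of Thm. 6.1. The deterministic Lemma 6.3 is the tree's theorem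
`restrictionDerivVanishesAtHit_of_stolz IsSmoothHull.hitPath_stolz_holds`; the passage to the
random driving function is `sle_restrictionDeriv_frequently_lt_of_restrictionDerivVanishesAtHit`.
This is the complete printed scope of the predicate `sle_restrictionDeriv_frequently_lt`, which
is not a closed statement (see `not_sle_restrictionDeriv_frequently_lt_singleton_zero`).
[cite: LawlerSchrammWerner2003Restriction, Lemma 6.3 and proof of Thm. 6.1 (§6)] -/
theorem sle_restrictionDeriv_frequently_lt_of_isSmoothHull (hA : IsSmoothHull A)
    (hAs : IsStarHull A) : sle_restrictionDeriv_frequently_lt A :=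
  sle_restrictionDeriv_frequently_lt_of_restrictionDerivVanishesAtHit hAs
    (restrictionDerivVanishesAtHit_of_stolz IsSmoothHull.hitPath_stolz_holds hA hAs)

/-- **"Lemma 6.3 shows that `Y_T = 0` on `{T < ∞}`"** (proof of [LSW] Thm. 6.1), now for every
restriction martingale `Y` of a smooth `*`-hull with no further hypothesis: almost surely, from
the finite hitting time `T` on, `Y_t = 0` (`IsRestrictionMartingale.ae_eq_zero_of_le` with
`sle_restrictionDeriv_frequently_lt_of_isSmoothHull`).
[cite: LawlerSchrammWerner2003Restriction, proof of Thm. 6.1 (§6)] -/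
theorem IsRestrictionMartingale.ae_eq_zero_of_isSmoothHull (hA : IsSmoothHull A)
    (hAs : IsStarHull A) (hY : IsRestrictionMartingale A Y) :
    ∀ᵐ ω ∂Process.preWienerMeasure, ∀ τ : ℝ≥0, firstHit (sleTrace ((8 : ℝ≥0) / 3) ω) A = τ →
      ∀ t : ℝ≥0, τ ≤ t → Y t ω = 0 :=
  hY.ae_eq_zero_of_le hAs (sle_restrictionDeriv_frequently_lt_of_isSmoothHull hA hAs)

end SLE

/-! ### The predicate is not a closed statement -/

/-- **The universal closure of the predicate `sle_restrictionDeriv_frequently_lt` fails**: the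
property does not hold for `A = {0}`. The SLE trace starts at `0`, so `T = 0` surely, and the
property then asks for times `s < 0` in `ℝ≥0` (`𝓝[<] 0`-frequently), of which there are none;
the pre-Wiener measure being a probability measure (`isProbabilityMeasure_preWienerMeasure'`),
"almost surely false" is false. Hence `sle_restrictionDeriv_frequently_lt` is a property of hulls
`A ∌ 0` to be established hull by hull (as in `sle_restrictionDeriv_frequently_lt_of_isSmoothHull`),
not a named fact admitting a discharge `theorem … : ∀ A, sle_restrictionDeriv_frequently_lt A`.
[folklore] -/
theorem not_sle_restrictionDeriv_frequently_lt_singleton_zero :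
    ¬ sle_restrictionDeriv_frequently_lt {(0 : ℂ)} := by
  intro h
  haveI := isProbabilityMeasure_preWienerMeasure'
  have hae : ∀ᵐ ω ∂Process.preWienerMeasure, False := by
    filter_upwards [h] with ω hω
    -- the trace starts at `0 ∈ {0}`: `T ≤ 0`
    have hle : firstHit (sleTrace ((8 : ℝ≥0) / 3) ω) {(0 : ℂ)} ≤ ((0 : ℝ≥0) : WithTop ℝ≥0) := by
      refine firstHit_le ?_
      change Loewner.trace (sleDriving ((8 : ℝ≥0) / 3) ω) 0 ∈ ({0} : Set ℂ)
      rw [Loewner.trace_zero, sleDriving_zero, Complex.ofReal_zero]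
      exact mem_singleton 0
    obtain ⟨τ, hτ⟩ := WithTop.ne_top_iff_exists.1 (hle.trans_lt (WithTop.coe_lt_top 0)).ne
    rw [← hτ] at hle
    have hτ0 : τ = 0 := le_antisymm (WithTop.coe_le_coe.1 hle) zero_le
    subst hτ0
    -- no time lies strictly before `0`
    obtain ⟨s, -, hs⟩ := ((hω 0 hτ.symm 1 one_pos).and_eventually self_mem_nhdsWithin).exists
    exact absurd hs (not_lt.2 zero_le)
  exact hae.exists.elim fun _ h ↦ h

end Literature.Probability.RandomPlanarGeometry

end
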